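import Mathlib
import Literature.NumberTheory.LFunctions.Zhang2022.Section11AFEWindowBounds
import Literature.NumberTheory.LFunctions.Zhang2022.Section11AFEAssembly
import Literature.NumberTheory.LFunctions.Zhang2022.Section11AFETailSmall
import HarnessLib

/-!
# Zhang (2022) §11, proof of Lemma 11.2 for `χψ` — sub-step (f) of `Z22:§11.u024` PROVED: the node
# `WindowMove11` ((6.5) for `χψ`: the segment `u = −1`, `|v| ≤ 𝓛²⁰` moved to `u = 0`)

Topic `Literature/NumberTheory/LFunctions/Zhang2022` (Landau–Siegel audit tree; verdict-neutral).
Y. Zhang, arXiv:2211.02515v1 (2022) [Zhang2022LandauSiegel] — **an unrefereed manuscript under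
adjudication** (campaign D-0069; nothing here bears on Theorems 1–2 or on Landau–Siegel zeros).
Companion of `Section11AFEWindowBounds`, `Section11AFEAssembly`. PROVED: `windowMove11_holds :
WindowMove11` (`c = 1/16`, `D ≥ e^{112}`; every `D`-dependent constant of `windowMove11_core` is
`≤ e^{O(𝓛⁹)}` — `k = Dp ≤ 3De^{𝓛⁹}`, `R = DPt₀`, `⌈P₁⌉ ≤ 2P`, `|t| ≤ 8𝓛⁵¹⁹` — against `e^{−𝓛¹⁰/8}`), and
the corollary `step11u024e_of_tail : TailSmall11 → Step11u024e`; with (6.2)-for-`χψ` PROVED in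
`Section11AFETailSmall` (`tailSmall11_holds`), the repaired Lemma 11.2 display is DISCHARGED:
`step11u024e_holds : Step11u024e` (all five sub-steps (b), (c), (d), (f), (g) and the blocks (a), (e),
(B2) kernel-checked; the print-verbatim `Step11u024`, without `+ε`, is NOT claimed — gap row G-d44-1).
[cite: Zhang2022LandauSiegel, §6 Lemma 6.1 (proof) (6.5) p. 32; §11 Lemma 11.2 p. 65]
-/

noncomputable section

open Complex Real ComplexConjugate MeasureTheory Set Filter Topology

namespace Literature.NumberTheory.LFunctions.Zhang2022.Section11AFE

open Skeleton GaussWeight Section6Statements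

/-! ## §1. The constants of (f) and the node `WindowMove11` -/

section BlockF

variable {D : ℕ} [NeZero D] (χ : DirichletCharacter ℂ D) (x : Chr D)

omit [NeZero D] in
/-- Powers of `𝓛` against `e^{𝓛⁹}`: `𝓛ⁿ ≤ e^{𝓛⁹}` for `n ≤ 𝓛⁸` (`𝓛 ≥ 1`). [folklore] -/
private theorem pow_le_exp_pow_nine {L : ℝ} (hL : 1 ≤ L) {n : ℕ} (hn : (n : ℝ) ≤ L ^ 8) :
    L ^ n ≤ Real.exp (L ^ 9) := by
  have h1 : L ≤ Real.exp L := by have := Real.add_one_le_exp L; linarith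
  have h0 : 0 ≤ L := by linarith
  calc L ^ n ≤ Real.exp L ^ n := pow_le_pow_left₀ h0 h1 n
    _ = Real.exp (n * L) := by rw [← Real.exp_nat_mul]
    _ ≤ Real.exp (L ^ 9) := Real.exp_le_exp.mpr (by
        calc (n : ℝ) * L ≤ L ^ 8 * L := mul_le_mul_of_nonneg_right hn h0
          _ = L ^ 9 := by ring)

omit [NeZero D] in
/-- The modulus of `ψ ∈ Ψ` satisfies `p ≤ 3P` (`P < p < P(1 + 𝓛⁻⁶⁸)`, `P ≥ 1`).
[cite: Zhang2022LandauSiegel, §2 p. 4] -/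
theorem chr_p_le_three_mul_bigP (hL : 1 ≤ ell D) : (x.p : ℝ) ≤ 3 * bigP D := by
  have hm := x.mem
  rw [primeWindow, Finset.mem_filter, Finset.mem_Ioo] at hm
  have hP : 0 < bigP D := Real.exp_pos _
  have hP1 : 1 ≤ bigP D := by rw [bigP]; exact Real.one_le_exp (by positivity)
  have hℓ : (ell D ^ 68)⁻¹ ≤ 1 := inv_le_one_of_one_le₀ (one_le_pow₀ hL)
  have h1 : (x.p : ℝ) < ⌈bigP D * (1 + (ell D ^ 68)⁻¹)⌉₊ := by exact_mod_cast hm.1.2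
  have h2 : (⌈bigP D * (1 + (ell D ^ 68)⁻¹)⌉₊ : ℝ) < bigP D * (1 + (ell D ^ 68)⁻¹) + 1 :=
    Nat.ceil_lt_add_one (by positivity)
  nlinarith

omit [NeZero D] in
/-- The constant bookkeeping of (f): with `E = e^{𝓛⁹}` and every `D`-dependent atom `≤ O(E^{O(1)})`,
the bound of `windowMove11_core` is `≤ C·e^{−𝓛¹⁰/16}` once `𝓛 ≥ 112`. [folklore] -/
private theorem windowMove11_consts {L G k2 R Nn Xi eb e8 e4 binv s4 s2 A2 tV2 : ℝ} (hL : 112 ≤ L)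
    (hG0 : 0 ≤ G) (hk2 : 0 ≤ k2) (hk2' : k2 ≤ 9 * Real.exp (L ^ 9) ^ 4) (hR : 0 ≤ R)
    (hR' : R ≤ Real.exp (L ^ 9) ^ 3) (hNn : 0 ≤ Nn) (hNn' : Nn ≤ 2 * Real.exp (L ^ 9)) (hXi : 0 ≤ Xi)
    (hXi' : Xi ≤ 1) (heb : 0 ≤ eb) (heb' : eb ≤ 3) (he8 : 0 ≤ e8) (he8' : e8 ≤ Real.exp (-(L ^ 10 / 8)))
    (he4 : 0 ≤ e4) (he4' : e4 ≤ Real.exp (-(L ^ 10 / 8))) (hbinv : 0 ≤ binv)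
    (hbinv' : binv ≤ 16 * Real.exp (L ^ 9)) (hs4 : 0 ≤ s4) (hs4' : s4 ≤ 8 * Real.exp (L ^ 9))
    (hs2 : 0 ≤ s2) (hs2' : s2 ≤ 6 * Real.exp (L ^ 9)) (hA2 : 0 ≤ A2) (hA2' : A2 ≤ 100 * Real.exp (L ^ 9))
    (htV2 : 0 ≤ tV2) (htV2' : tV2 ≤ 81 * Real.exp (L ^ 9)) :
    (G * k2 + R) * Nn * (Xi * eb) * (e8 * (binv * s4 + 2 * A2 * s2)) +
        2 * ((4 * k2 * tV2 + R) * Nn * eb * e4) ≤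
      (7968 * (9 * G + 1) + 35004) * Real.exp (-(1 / 16) * L ^ 10) := by
  set E : ℝ := Real.exp (L ^ 9) with hE
  have hE1 : 1 ≤ E := Real.one_le_exp (by positivity)
  have hL0 : 0 < L := by linarith
  set q : ℝ := Real.exp (-(L ^ 10 / 8)) with hq
  have hq0 : 0 ≤ q := Real.exp_nonneg _
  have hE34 : E ^ 3 ≤ E ^ 4 := pow_le_pow_right₀ hE1 (by norm_num)
  have hE35 : E ^ 3 ≤ E ^ 5 := pow_le_pow_right₀ hE1 (by norm_num)
  have hE67 : E ^ 6 ≤ E ^ 7 := pow_le_pow_right₀ hE1 (by norm_num)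
  have h1 : G * k2 + R ≤ (9 * G + 1) * E ^ 4 := by
    nlinarith [mul_le_mul_of_nonneg_left hk2' hG0]
  have h1' : 0 ≤ G * k2 + R := by positivity
  have h2 : 4 * k2 * tV2 + R ≤ 2917 * E ^ 5 := by
    have : 4 * k2 * tV2 ≤ 4 * (9 * E ^ 4) * (81 * E) := by gcongr
    nlinarith
  have h2' : 0 ≤ 4 * k2 * tV2 + R := by positivity
  have hM : binv * s4 + 2 * A2 * s2 ≤ 1328 * E ^ 2 := by
    have ha : binv * s4 ≤ 16 * E * (8 * E) := by gcongr
    have hb : 2 * A2 * s2 ≤ 2 * (100 * E) * (6 * E) := by gcongr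
    nlinarith
  have hM' : 0 ≤ binv * s4 + 2 * A2 * s2 := by positivity
  have hfin : E ^ 7 * q ≤ Real.exp (-(1 / 16) * L ^ 10) := by
    rw [hE, hq, ← Real.exp_nat_mul, ← Real.exp_add]
    refine Real.exp_le_exp.mpr ?_
    have h9 : L ^ 10 = L * L ^ 9 := by ring
    nlinarith [pow_nonneg hL0.le 9]
  calc (G * k2 + R) * Nn * (Xi * eb) * (e8 * (binv * s4 + 2 * A2 * s2)) +
        2 * ((4 * k2 * tV2 + R) * Nn * eb * e4)
      ≤ ((9 * G + 1) * E ^ 4) * (2 * E) * (1 * 3) * (q * (1328 * E ^ 2)) +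
        2 * ((2917 * E ^ 5) * (2 * E) * 3 * q) := by
        gcongr
    _ = (7968 * (9 * G + 1) * E ^ 7 + 35004 * E ^ 6) * q := by ring
    _ ≤ (7968 * (9 * G + 1) * E ^ 7 + 35004 * E ^ 7) * q := by gcongr
    _ = (7968 * (9 * G + 1) + 35004) * (E ^ 7 * q) := by ring
    _ ≤ (7968 * (9 * G + 1) + 35004) * Real.exp (-(1 / 16) * L ^ 10) := by gcongr

omit [NeZero D] in
/-- The `𝓛`-only atoms of (f): Gaussian widths and the two exponentials (`b = 1/(4𝓛³⁰)`, `V = 𝓛²⁰`).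
[folklore] -/
private theorem windowMove11_Latoms {L : ℝ} (hL1 : 1 ≤ L) :
    Real.sqrt (π / (1 / (4 * L ^ 30) / 4)) ≤ 8 * L ^ 15 ∧
      Real.sqrt (π / (1 / (4 * L ^ 30) / 2)) ≤ 6 * L ^ 15 ∧
      4 / (1 / (4 * L ^ 30)) = 16 * L ^ 30 ∧
      Real.exp (1 / (4 * L ^ 30)) ≤ 3 ∧
      Real.exp (-(1 / (4 * L ^ 30) / 2) * (L ^ 20) ^ 2) ≤ Real.exp (-(L ^ 10 / 8)) ∧
      Real.exp (-(1 / (4 * L ^ 30)) * (L ^ 20) ^ 2) ≤ Real.exp (-(L ^ 10 / 8)) := by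
  have hL0 : 0 < L := by linarith
  have h30 : 0 < L ^ 30 := by positivity
  have h15 : 0 ≤ L ^ 15 := by positivity
  have h1530 : (L ^ 15) ^ 2 = L ^ 30 := by ring
  have hπ := Real.pi_lt_four
  refine ⟨?_, ?_, ?_, ?_, ?_, ?_⟩
  · have e : π / (1 / (4 * L ^ 30) / 4) = 16 * π * L ^ 30 := by field_simp; ring
    rw [e]
    have h : 16 * π * L ^ 30 ≤ (8 * L ^ 15) ^ 2 := by
      rw [mul_pow, h1530]; exact mul_le_mul_of_nonneg_right (by linarith) h30.le
    calc Real.sqrt (16 * π * L ^ 30) ≤ Real.sqrt ((8 * L ^ 15) ^ 2) := Real.sqrt_le_sqrt h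
      _ = 8 * L ^ 15 := Real.sqrt_sq (by positivity)
  · have e : π / (1 / (4 * L ^ 30) / 2) = 8 * π * L ^ 30 := by field_simp; ring
    rw [e]
    have h : 8 * π * L ^ 30 ≤ (6 * L ^ 15) ^ 2 := by
      rw [mul_pow, h1530]; exact mul_le_mul_of_nonneg_right (by linarith) h30.le
    calc Real.sqrt (8 * π * L ^ 30) ≤ Real.sqrt ((6 * L ^ 15) ^ 2) := Real.sqrt_le_sqrt h
      _ = 6 * L ^ 15 := Real.sqrt_sq (by positivity)
  · field_simp; ring
  · have h1 : (1 : ℝ) ≤ L ^ 30 := one_le_pow₀ hL1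
    have : 1 / (4 * L ^ 30) ≤ 1 := by rw [div_le_one (by positivity)]; linarith
    calc Real.exp (1 / (4 * L ^ 30)) ≤ Real.exp 1 := Real.exp_le_exp.mpr this
      _ ≤ 3 := by have := Real.exp_one_lt_d9; linarith
  · refine le_of_eq ?_; congr 1; field_simp; ring
  · refine Real.exp_le_exp.mpr ?_
    have e : -(1 / (4 * L ^ 30)) * (L ^ 20) ^ 2 = -(L ^ 10 / 4) := by field_simp
    rw [e]
    have : 0 ≤ L ^ 10 := by positivity
    linarith

/-- **(f) PROVED**: the node `WindowMove11` holds, with `c = 1/16` and `D ≥ e^{112}` — the segment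
`u = −1`, `|v| ≤ 𝓛²⁰` is moved to `u = 0`, `|v| ≤ 𝓛²⁰` (`Z22:Lem6.1.pf` (6.5) for `χψ`): the rectangle
(`windowMove11_core`) costs `(K₀M + 2K₁e^{b})e^{−𝓛¹⁰/8}` with `K₀M + 2K₁e^{b} ≤ C·e^{7𝓛⁹} ≤ Ce^{𝓛¹⁰/16}`
(`k = Dp ≤ 3De^{𝓛⁹}`, `R = DPt₀`, `⌈P₁⌉ ≤ 2P`, `|t| ≤ 2πt₀ + 𝓛₁`, all `≤ e^{O(𝓛⁹)}`).
[cite: Zhang2022LandauSiegel, §6 (6.5) p. 32; §11 p. 65] -/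
theorem windowMove11_holds : WindowMove11 := by
  obtain ⟨G, hG0, hG⟩ := StripGrowth.exists_norm_Zfac_le (A := 1) le_rfl
  refine ⟨1 / 16, by norm_num, 7968 * (9 * G + 1) + 35004, ⌈Real.exp 112⌉₊,
    fun D _ χ hD _hq hp x s hs z hz1 _hz2 => ?_⟩
  -- `𝓛 ≥ 112`
  have hexp : Real.exp 112 ≤ D := le_trans (Nat.le_ceil _) (by exact_mod_cast hD)
  have hL : 112 ≤ ell D := (Real.le_log_iff_exp_le (lt_of_lt_of_le (Real.exp_pos _) hexp)).mpr hexp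
  have hD3 : 3 ≤ D := by
    have h3 : (3 : ℝ) ≤ Real.exp 112 := by have := Real.add_one_le_exp (112 : ℝ); linarith
    exact_mod_cast h3.trans hexp
  have hcore := windowMove11_core χ x hG0.le hG hD3 hp (by linarith) hs hz1
  refine hcore.trans ?_
  obtain ⟨hre, him⟩ := hs
  set L : ℝ := ell D with hLdef
  have hL1 : 1 ≤ L := by linarith
  have hL0 : 0 < L := by linarith
  obtain ⟨hs4, hs2, hbinv, hb1, hE8, hE4⟩ := windowMove11_Latoms hL1
  set E : ℝ := Real.exp (L ^ 9) with hEdef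
  have hE0 : 0 < E := Real.exp_pos _
  have hE1 : 1 ≤ E := Real.one_le_exp (pow_nonneg hL0.le 9)
  have hP : bigP D = E := rfl
  have hDexp : (D : ℝ) = Real.exp L := by
    rw [hLdef, ell, Real.exp_log]; exact_mod_cast lt_of_lt_of_le (by norm_num) hD3
  have hDE : (D : ℝ) ≤ E := by
    rw [hDexp, hEdef]; refine Real.exp_le_exp.mpr ?_
    calc L = L ^ 1 := (pow_one L).symm
      _ ≤ L ^ 9 := pow_le_pow_right₀ hL1 (by norm_num)
  have hL8 : (2000 : ℝ) ≤ L ^ 8 := by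
    calc (2000 : ℝ) ≤ 112 ^ 2 := by norm_num
      _ ≤ L ^ 2 := pow_le_pow_left₀ (by norm_num) hL 2
      _ ≤ L ^ 8 := pow_le_pow_right₀ hL1 (by norm_num)
  have hpow : ∀ n : ℕ, (n : ℝ) ≤ 2000 → L ^ n ≤ E := fun n hn =>
    pow_le_exp_pow_nine hL1 (hn.trans hL8)
  -- the `D`-dependent atoms
  have hp3 : (x.p : ℝ) ≤ 3 * E := by rw [← hP]; exact chr_p_le_three_mul_bigP x (by linarith)
  have hk : ((D * x.p : ℕ) : ℝ) ≤ 3 * E ^ 2 := by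
    push_cast
    calc (D : ℝ) * x.p ≤ E * (3 * E) := mul_le_mul hDE hp3 (Nat.cast_nonneg _) hE0.le
      _ = 3 * E ^ 2 := by ring
  have hk2 : ((D * x.p : ℕ) : ℝ) ^ 2 ≤ 9 * E ^ 4 := by
    calc ((D * x.p : ℕ) : ℝ) ^ 2 ≤ (3 * E ^ 2) ^ 2 := pow_le_pow_left₀ (Nat.cast_nonneg _) hk 2
      _ = 9 * E ^ 4 := by ring
  have ht0 : t0 D = L ^ 519 := rfl
  have h519 : 0 ≤ L ^ 519 := pow_nonneg hL0.le 519
  have hR0 : 0 ≤ bigR D := by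
    rw [bigR, ht0, hP]; exact mul_nonneg (mul_nonneg (Nat.cast_nonneg _) hE0.le) h519
  have hRle : bigR D ≤ E ^ 3 := by
    rw [bigR, ht0, hP]
    calc (D : ℝ) * E * L ^ 519 ≤ E * E * E :=
          mul_le_mul (mul_le_mul_of_nonneg_right hDE hE0.le) (hpow 519 (by norm_num)) h519
            (mul_nonneg hE0.le hE0.le)
      _ = E ^ 3 := by ring
  have hP10 : 0 ≤ Skeleton.P1 D := by rw [Skeleton.P1, hP]; exact Real.rpow_nonneg hE0.le _
  have hN : (⌈Skeleton.P1 D⌉₊ : ℝ) ≤ 2 * E := by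
    have hP1le : Skeleton.P1 D ≤ E := by
      rw [Skeleton.P1, hP]
      calc E ^ (0.504 : ℝ) ≤ E ^ (1 : ℝ) := Real.rpow_le_rpow_of_exponent_le hE1 (by norm_num)
        _ = E := Real.rpow_one E
    have h' : (⌈Skeleton.P1 D⌉₊ : ℝ) < Skeleton.P1 D + 1 := Nat.ceil_lt_add_one hP10
    linarith
  have hX1 : 1 ≤ bigP D ^ z := by rw [hP]; exact Real.one_le_rpow hE1 (by linarith)
  have hXinv : (bigP D ^ z)⁻¹ ≤ 1 := inv_le_one_of_one_le₀ hX1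
  have hXinv0 : 0 ≤ (bigP D ^ z)⁻¹ := inv_nonneg.mpr (by linarith)
  -- `|t| ≤ 8 L⁵¹⁹`
  have htabs : |s.im| ≤ 8 * L ^ 519 := by
    have h := abs_lt.mp him
    rw [ell1, ht0] at h
    have h405 : L ^ 405 ≤ L ^ 519 := pow_le_pow_right₀ hL1 (by norm_num)
    have h2pi : 2 * π * L ^ 519 ≤ 7 * L ^ 519 := by
      have : 2 * π ≤ 7 := by linarith [Real.pi_lt_d2]
      exact mul_le_mul_of_nonneg_right this h519
    have hlow : 0 ≤ s.im := by
      have : 6 * L ^ 519 ≤ 2 * π * L ^ 519 :=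
        mul_le_mul_of_nonneg_right (by linarith [Real.pi_gt_three]) h519
      linarith [h.1]
    rw [abs_of_nonneg hlow]; linarith [h.2]
  have h1038 : L ^ 1038 ≤ E := hpow 1038 (by norm_num)
  have htV : (|s.im| + |L ^ 20|) ^ 2 ≤ 81 * E := by
    have h20 : |L ^ 20| ≤ L ^ 519 := by
      rw [abs_of_nonneg (pow_nonneg hL0.le 20)]; exact pow_le_pow_right₀ hL1 (by norm_num)
    have h1 : |s.im| + |L ^ 20| ≤ 9 * L ^ 519 := by linarith
    have h0 : 0 ≤ |s.im| + |L ^ 20| := by positivity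
    calc (|s.im| + |L ^ 20|) ^ 2 ≤ (9 * L ^ 519) ^ 2 := pow_le_pow_left₀ h0 h1 2
      _ = 81 * L ^ 1038 := by ring
      _ ≤ 81 * E := by linarith
  have hA2 : (|s.im| + 2) ^ 2 ≤ 100 * E := by
    have h1 : |s.im| + 2 ≤ 10 * L ^ 519 := by
      have : (1 : ℝ) ≤ L ^ 519 := one_le_pow₀ hL1
      linarith
    calc (|s.im| + 2) ^ 2 ≤ (10 * L ^ 519) ^ 2 := pow_le_pow_left₀ (by positivity) h1 2
      _ = 100 * L ^ 1038 := by ring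
      _ ≤ 100 * E := by linarith
  have h15 : L ^ 15 ≤ E := hpow 15 (by norm_num)
  have h30 : L ^ 30 ≤ E := hpow 30 (by norm_num)
  rw [hbinv]
  exact windowMove11_consts hL hG0.le (by positivity) hk2 hR0 hRle (Nat.cast_nonneg _) hN hXinv0
    hXinv (Real.exp_nonneg _) hb1 (Real.exp_nonneg _) hE8 (Real.exp_nonneg _) hE4 (by positivity)
    (by linarith) (Real.sqrt_nonneg _) (hs4.trans (by linarith)) (Real.sqrt_nonneg _)
    (hs2.trans (by linarith)) (by positivity) hA2 (by positivity) htV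


/-- **`Z22:§11.u024` (repaired) from (6.2)-for-`χψ` alone**: with (f) `windowMove11_holds` the smoothed
approximate functional equation `Step11u024e` follows from the single remaining contour claim
`TailSmall11` (the reflected tail `n ≥ P₁`, contour at `u = −𝓛⁹`).
[cite: Zhang2022LandauSiegel, §11 Lemma 11.2 (proof), p. 65] -/
theorem step11u024e_of_tail (hd : TailSmall11) : Step11u024e :=
  step11u024e_of_tail_window hd windowMove11_holds

/-- **`Z22:§11.u024` (REPAIRED display, gap row G-d44-1) DISCHARGED**: the smoothed approximate
functional equation for `L(s,χψ)` of the proof of Lemma 11.2 — `Σ_nχψ(n)n^{−s}g(P^z/n) = L(s,χψ) −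
Z(s,χψ)Σ_nχψ̄(n)n^{−(1−s)}g(P^{1−z}Dt₀/n) + O(E₂(s,ψ) + e^{−c𝓛¹⁰})` for `ψ ∈ Ψ`, `σ = 1/2`,
`|t − 2πt₀| < 𝓛₁`, `0.5 ≤ z ≤ 0.504`, `D` large (under the blanket (A), unused) — holds: "in a way
similar to the proof of Lemma 6.1" carried out in the kernel for `χψ (mod Dp)`, sub-steps
(b) `shiftPole11_holds`, (c) `lineSplit11_holds`, (d) `tailSmall11_holds`, (f) `windowMove11_holds`,
(g) `dualTail11_holds` composed by `Section11AFEAssembly.step11u024e_of`. The printed error `O(E₂)`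
(tex L3331, `Typed.TypedSection11B.Step11u024`) is NOT derived: the `ε = exp{−c𝓛¹⁰}` of Lemma 6.1's
`E₁` is genuinely present (cell gap row G-d44-1, class in-cone/repairable).
[cite: Zhang2022LandauSiegel, §11 Lemma 11.2 (proof), p. 65, tex L3329–3331; §6 Lemma 6.1 pp. 30–32] -/
theorem step11u024e_holds : Step11u024e :=
  step11u024e_of_tail tailSmall11_holds

end BlockF

end Literature.NumberTheory.LFunctions.Zhang2022.Section11AFE
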